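import Literature.MathematicalPhysics.QuantumFieldTheory.Balaban1983to89.B11Eq103H1Complex
import Literature.MathematicalPhysics.QuantumFieldTheory.Balaban1983to89.B9Eq315QLipschitz

/-!
# `Balaban1983to89.B11Eq117TransformationNorm` — T. Bałaban, *The variational problem and background fields in renormalization group method for
# lattice gauge theories*, Commun. Math. Phys. **102** (1985) 277–309 [Balaban1985Variational] (117) p. 295 «the norm max{|·|_(−1), |∇·|_(−2)}
# of the transformation»: FINITE-LATTICE NORM COMPARISONS for the letters of the space (115) — the operator norm of a transformation
# `|·|_(−n) → (115)` (`B11Eq111FrakG.toCLM115`, `B11Eq103H1Complex.blockCLM115` / `H1CLM`) is controlled by a sup→sup bound of the underlying map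
# of functions, a sup→sup bound of the derivative letter `∇`, and the extreme weights; the sup→sup bound of an `L²`-operator read on the functions
# (`readFun`) is controlled by its `L²` bound; `‖∇_{U₀}A‖_∞ ≤ 2|η|⁻¹‖A‖_∞` for unit-bounded backgrounds ([5] (3.3))

statement-level skeleton of published theorems with citation tags; proofs where landed; nothing here is a claim
about the Yang–Mills mass gap

PDF held: `paper:balaban1985-cmp102-variational-background` (journal page = PDF page + 276), pp. 286, 293–295 read through the verbatim quotations of
`B11Eq115Space` / `B11Eq111FrakG` / `B11Eq103H1Complex`; [5] = [Balaban1985BackgroundPropagators] (3.3) p. 391, (3.11) p. 392.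

THE PRINT (first-hand, text layer p. 295 L3–L11).  *«A solution of Eq. (111) is a fixed point of the transformation [(116)].  At first let us
investigate for which ε₄ this transformation maps the space (115) into itself. By Theorem 3.13 of [5] the norm max{| |_(−1), |∇ |_(−2)} of the
transformation can be estimated by [(117)] if ε₄ + B₀|B| ≤ a₃. Further, we have the bound |B| < 2dLC₁ε₁; hence the transformation (116) transforms
the space (115) into itself if ε₄ + 2dLB₀C₁ε₁ ≤ a₃, B₀C₄(ε₄ + 2dLB₀C₁ε₁)² ≤ ε₄. (118)»* — the constant `B₀` of (117) is A BOUND of the operators `G₁`,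
`𝔊` between the size `|·|_(−3)` and the norm of (115) ((110) p. 294, and for `H₁` the inequality (103) p. 293), UNIFORM in the lattice by [5] =
[Balaban1985BackgroundPropagators] Thm 3.13 p. 426 (the decay/regularity of `𝔊`; Thm 3.4 p. 400 for the perturbation in the background).  Here —
the cell's finite-lattice reading — the comparison constants are the elementary ones of a FINITE index set: every weighted sup size and every
weighted `L²` size ((3.11) of [5]) of `𝔤ᶜ`-valued lattice functions are comparable, with constants depending on the extreme weights and the number
of points only (the volume factor `√#β` of §2 IS load-bearing; print avoids it by Thm 3.13's decay, NOT available here).  WHY THIS FILE: the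
pub-balaban NE9 chain's letters `H₁(U) = H1LatticeCLM …`, `𝔊(U) = frakGLatticeCLM …` are `L²` operators (`H1LatticeK`, `frakGLatticeK`, bounded
uniformly over the small-field set by `B9Eq3126H1Bound`) READ in the type `NegSize → Space115 … (∇_U)`; to choose the chart radii of
[Balaban1985Variational] Prop. 6 uniformly in the background one needs their OPERATOR norms in that type bounded uniformly — (117)'s «norm of the
transformation» computed from the `L²` bounds by the comparisons below, with U-independent constants as soon as `‖U(b)‖, ‖U(b)⁻¹‖ ≤ 1`.
(v1.1 DOCFIX, gen 81: the v1 header paraphrased p. 295 inside «…» quotes — readers ne9-leaf-02 g56 X9 MISQUOTATION-LOW-1, ne9-leaf-06 g59 W-4; replaced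
by the verbatim text; cite locus (100) ↦ (103) for H₁; statements and proofs byte-identical.)

WHAT IS PROVED (sorry-free; [folklore] finite-dimensional norm comparisons; no `Prop` placeholder; no inequality of the paper asserted).
* `norm_jetSymm_le` — `‖A‖_(115) ≤ max(w̄₀, w̄₁·M_∇)·‖A‖_∞` for the configuration `A` read in (115), `M_∇` a sup→sup bound of the derivative letter
  (`JetSup.norm_def`, `NegSup.norm_le_wSup_mul`).
* **`norm_toCLM115_apply_le` / `norm_toCLM115_le`**, **`norm_blockCLM115_apply_le` / `norm_blockCLM115_le`** — the operator norm of a transformation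
  `|·|_(−3) → (115)` / `|·|_(−0) → (115)` is at most `max(w̄₀, w̄₁M_∇)·M_T·w̲⁻¹` (`M_T` a sup→sup bound of the map of functions, `w̲⁻¹` the largest
  inverse input weight, `NegSup.sup_norm_le_wInvSup_mul`).
* **`norm_readFun_apply_le`** — an `L²` operator `T` with `‖Tf‖ ≤ C_T‖f‖` between constant-weight `L²` spaces (weights `c₁` in, `c₀` out), read on the
  functions along a fibre identification `φ` (`‖φw‖ ≤ M_φ‖w‖`, `‖φ⁻¹X‖ ≤ M_φ′‖X‖`), is sup→sup bounded by `M_φ·C_T·√(c₁·#β)·M_φ′/√c₀`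
  (`B9Eq315QLipschitz.norm_apply_le_of_WL2` / `norm_WL2_le_of_pointwise`).
* **`norm_H1CLM_le`** — hence `‖H1CLM φ lev₁ ∇ H₁‖ ≤ max(w̄₀, w̄₁M_∇)·(M_φC_T√(c₁#β)M_φ′/√c₀)·w̲⁻¹` from an `L²` bound `C_T` of `H₁`.
* `frakGLin_fun_eq_readFun` — the function-level `𝔊`-formula of `B11Eq111FrakG.frakGLin` at the READ letters (`G1Fun`, `QFun`, `QadjFun`, `DFun`,
  `DstarFun` of `B11Eq103H1Complex`) IS the Hilbert-level `frakGLin … (Q† …)` read on the functions; **`norm_frakG_fun_le`** — hence the operator norm of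
  `frakG lev₁ ∇ (G1Fun φ G₁) (QFun φ Q) (QadjFun φ Q) K⁻¹ (DFun φ D) R (DstarFun φ D*)` from an `L²` bound of `frakGLin G₁ Q Q† K⁻¹ D R D*`.
* **`norm_nabla115_le`** — `‖∇_{U₀}A‖_∞ ≤ 2‖η⁻¹‖·‖A‖_∞` when `‖U₀(b)‖ ≤ 1`, `‖U₀(b)⁻¹‖ ≤ 1` ([5] (3.3): `η⁻¹(U A U⁻¹ − A)`).
MODEL / HONEST SCOPE.  Finite index sets, finite-dimensional fibre; the constants are finite-lattice numbers (extreme weights `(L^jη)^n`, `#β`,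
`c₀`, `c₁`, `M_φ`, `M_φ′`) — NOT print's lattice-uniform `B₀`; NOT summit progress (cell pub-balaban: NE9 NOT PRINTED / NOT PROVED; spine PROVED 0/9).
Filed by the pub-balaban NE9 BINDER-row owner lineage `b2b-balaban-t4-ne9-p1` (gen 81); NEW file importing `B11Eq103H1Complex`, `B9Eq315QLipschitz`
only; nothing modified.  Net new unproved facts: 0.
-/

noncomputable section

namespace Literature.MathematicalPhysics.QuantumFieldTheory.Balaban1983to89.B11Eq117TransformationNorm

open Metric Set
open B11Eq115Space B11Eq111FrakG B11Eq103H1Complex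
open B9Eq311L2Pairing (WL2)
open B9Eq315QLipschitz (norm_apply_le_of_WL2 norm_WL2_le_of_pointwise)
open B9SectCLatticeCarrier (Bond)

/-! ## §1 The norm of (115) against the sup norm of the underlying function -/

section Jet

variable {ι κ : Type*} [Fintype ι] [Fintype κ] {V : Type*} [NormedAddCommGroup V] [NormedSpace ℂ V] [FiniteDimensional ℂ V]
  {L η : ℝ} [Fact (0 < L)] [Fact (0 < η)] {lev₀ : ι → ℕ}

omit [FiniteDimensional ℂ V] in
/-- **`‖A‖_(115) ≤ max(w̄₀, w̄₁·M_∇)·‖A‖_∞`**: the norm `max{|A|_(−1), |∇A|_(−2)}` of a configuration against the sup norm of the function, given a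
sup→sup bound `M_∇` of the derivative letter; `w̄₀`, `w̄₁` the largest weights `L^jη`, `(L^jη)²`. [cite: Balaban1985Variational, (115) p.294, p.286] -/
theorem norm_jetSymm_le (lev₁ : κ → ℕ) (Dc : (ι → V) →ₗ[ℂ] (κ → V)) {MD : ℝ} (hD : ∀ g, ‖Dc g‖ ≤ MD * ‖g‖) (h : ι → V) :
    ‖(jetLinearEquiv L η lev₀ lev₁ Dc).symm h‖ ≤
      max (NegSup.wSup (levWeight L η lev₀ 1) : ℝ) (NegSup.wSup (levWeight L η lev₁ 2) * MD) * ‖h‖ := by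
  have h1 : JetSup.equiv _ _ Dc ((jetLinearEquiv L η lev₀ lev₁ Dc).symm h) = h :=
    (jetLinearEquiv L η lev₀ lev₁ Dc).apply_symm_apply h
  refine (JetSup.norm_le_iff (𝕜 := ℂ) (w₀ := levWeight L η lev₀ 1) (w₁ := levWeight L η lev₁ 2) (D := Dc)).2 ⟨?_, ?_⟩
  · have h2 := NegSup.norm_le_wSup_mul (JetSup.fst ((jetLinearEquiv L η lev₀ lev₁ Dc).symm h))
    rw [JetSup.equiv_fst, h1] at h2
    exact h2.trans (mul_le_mul_of_nonneg_right (le_max_left _ _) (norm_nonneg _))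
  · have h2 := NegSup.norm_le_wSup_mul (JetSup.snd ((jetLinearEquiv L η lev₀ lev₁ Dc).symm h))
    rw [JetSup.equiv_snd, h1] at h2
    have h3 : (NegSup.wSup (levWeight L η lev₁ 2) : ℝ) * ‖Dc h‖ ≤ NegSup.wSup (levWeight L η lev₁ 2) * MD * ‖h‖ := by
      rw [mul_assoc]; exact mul_le_mul_of_nonneg_left (hD h) (NegSup.wSup (levWeight L η lev₁ 2)).coe_nonneg
    exact (h2.trans h3).trans (mul_le_mul_of_nonneg_right (le_max_right _ _) (norm_nonneg _))

/-- **THE NORM OF A TRANSFORMATION `|·|_(−3) → (115)`, pointwise form**: `‖Tf‖_(115) ≤ max(w̄₀, w̄₁M_∇)·M_T·w̲₃⁻¹·‖f‖_(−3)` for `B11Eq111FrakG.toCLM115 T`,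
`M_T` a sup→sup bound of the map of functions `T`, `w̲₃⁻¹` the largest inverse weight of `|·|_(−3)`. [cite: Balaban1985Variational, (117) p.295] -/
theorem norm_toCLM115_apply_le (lev₁ : κ → ℕ) (Dc : (ι → V) →ₗ[ℂ] (κ → V)) (T : (ι → V) →ₗ[ℂ] (ι → V)) {MT MD : ℝ} (hMT : 0 ≤ MT)
    (hT : ∀ g, ‖T g‖ ≤ MT * ‖g‖) (hD : ∀ g, ‖Dc g‖ ≤ MD * ‖g‖) (f : NegSize L η lev₀ 3 V) :
    ‖toCLM115 (L := L) (η := η) (lev₀ := lev₀) lev₁ Dc T f‖ ≤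
      max (NegSup.wSup (levWeight L η lev₀ 1) : ℝ) (NegSup.wSup (levWeight L η lev₁ 2) * MD) * MT * NegSup.wInvSup (levWeight L η lev₀ 3) * ‖f‖ := by
  have hK : 0 ≤ max (NegSup.wSup (levWeight L η lev₀ 1) : ℝ) (NegSup.wSup (levWeight L η lev₁ 2) * MD) :=
    le_max_of_le_left (NegSup.wSup (levWeight L η lev₀ 1)).coe_nonneg
  have h0 : toCLM115 (L := L) (η := η) (lev₀ := lev₀) lev₁ Dc T f =
      (jetLinearEquiv L η lev₀ lev₁ Dc).symm (T (NegSup.equiv _ V f)) := rfl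
  rw [h0]
  refine (norm_jetSymm_le lev₁ Dc hD _).trans ?_
  have h1 : ‖T (NegSup.equiv _ V f)‖ ≤ MT * (NegSup.wInvSup (levWeight L η lev₀ 3) * ‖f‖) :=
    (hT _).trans (mul_le_mul_of_nonneg_left (NegSup.sup_norm_le_wInvSup_mul f) hMT)
  calc max (NegSup.wSup (levWeight L η lev₀ 1) : ℝ) (NegSup.wSup (levWeight L η lev₁ 2) * MD) * ‖T (NegSup.equiv _ V f)‖
      ≤ max (NegSup.wSup (levWeight L η lev₀ 1) : ℝ) (NegSup.wSup (levWeight L η lev₁ 2) * MD) * (MT * (NegSup.wInvSup (levWeight L η lev₀ 3) * ‖f‖)) :=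
        mul_le_mul_of_nonneg_left h1 hK
    _ = _ := by ring

/-- **THE NORM OF A TRANSFORMATION `|·|_(−3) → (115)`** (operator-norm form). [cite: Balaban1985Variational, (117) p.295] -/
theorem norm_toCLM115_le (lev₁ : κ → ℕ) (Dc : (ι → V) →ₗ[ℂ] (κ → V)) (T : (ι → V) →ₗ[ℂ] (ι → V)) {MT MD : ℝ} (hMT : 0 ≤ MT)
    (hT : ∀ g, ‖T g‖ ≤ MT * ‖g‖) (hD : ∀ g, ‖Dc g‖ ≤ MD * ‖g‖) :
    ‖toCLM115 (L := L) (η := η) (lev₀ := lev₀) lev₁ Dc T‖ ≤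
      max (NegSup.wSup (levWeight L η lev₀ 1) : ℝ) (NegSup.wSup (levWeight L η lev₁ 2) * MD) * MT * NegSup.wInvSup (levWeight L η lev₀ 3) := by
  refine ContinuousLinearMap.opNorm_le_bound _ ?_ (norm_toCLM115_apply_le lev₁ Dc T hMT hT hD)
  exact mul_nonneg (mul_nonneg (le_max_of_le_left (NegSup.wSup (levWeight L η lev₀ 1)).coe_nonneg) hMT)
    (NegSup.wInvSup (levWeight L η lev₀ 3)).coe_nonneg

variable {β : Type*} [Fintype β] {levB : β → ℕ}

/-- **THE NORM OF A TRANSFORMATION `|·|_(−0) → (115)`** (block fields to configurations), pointwise form: the same comparison for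
`B11Eq103H1Complex.blockCLM115 T`. [cite: Balaban1985Variational, (103) p.293, (117) p.295] -/
theorem norm_blockCLM115_apply_le (lev₁ : κ → ℕ) (Dc : (ι → V) →ₗ[ℂ] (κ → V)) (T : (β → V) →ₗ[ℂ] (ι → V)) {MT MD : ℝ} (hMT : 0 ≤ MT)
    (hT : ∀ g, ‖T g‖ ≤ MT * ‖g‖) (hD : ∀ g, ‖Dc g‖ ≤ MD * ‖g‖) (B : NegSize L η levB 0 V) :
    ‖blockCLM115 (L := L) (η := η) (lev₀ := lev₀) lev₁ Dc T B‖ ≤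
      max (NegSup.wSup (levWeight L η lev₀ 1) : ℝ) (NegSup.wSup (levWeight L η lev₁ 2) * MD) * MT * NegSup.wInvSup (levWeight L η levB 0) * ‖B‖ := by
  have hK : 0 ≤ max (NegSup.wSup (levWeight L η lev₀ 1) : ℝ) (NegSup.wSup (levWeight L η lev₁ 2) * MD) :=
    le_max_of_le_left (NegSup.wSup (levWeight L η lev₀ 1)).coe_nonneg
  have h0 : blockCLM115 (L := L) (η := η) (lev₀ := lev₀) lev₁ Dc T B =
      (jetLinearEquiv L η lev₀ lev₁ Dc).symm (T (NegSup.equiv _ V B)) := rfl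
  rw [h0]
  refine (norm_jetSymm_le lev₁ Dc hD _).trans ?_
  have h1 : ‖T (NegSup.equiv _ V B)‖ ≤ MT * (NegSup.wInvSup (levWeight L η levB 0) * ‖B‖) :=
    (hT _).trans (mul_le_mul_of_nonneg_left (NegSup.sup_norm_le_wInvSup_mul B) hMT)
  calc max (NegSup.wSup (levWeight L η lev₀ 1) : ℝ) (NegSup.wSup (levWeight L η lev₁ 2) * MD) * ‖T (NegSup.equiv _ V B)‖
      ≤ max (NegSup.wSup (levWeight L η lev₀ 1) : ℝ) (NegSup.wSup (levWeight L η lev₁ 2) * MD) * (MT * (NegSup.wInvSup (levWeight L η levB 0) * ‖B‖)) :=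
        mul_le_mul_of_nonneg_left h1 hK
    _ = _ := by ring

/-- **THE NORM OF A TRANSFORMATION `|·|_(−0) → (115)`** (operator-norm form). [cite: Balaban1985Variational, (103) p.293, (117) p.295] -/
theorem norm_blockCLM115_le (lev₁ : κ → ℕ) (Dc : (ι → V) →ₗ[ℂ] (κ → V)) (T : (β → V) →ₗ[ℂ] (ι → V)) {MT MD : ℝ} (hMT : 0 ≤ MT)
    (hT : ∀ g, ‖T g‖ ≤ MT * ‖g‖) (hD : ∀ g, ‖Dc g‖ ≤ MD * ‖g‖) :
    ‖blockCLM115 (L := L) (η := η) (lev₀ := lev₀) (levB := levB) lev₁ Dc T‖ ≤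
      max (NegSup.wSup (levWeight L η lev₀ 1) : ℝ) (NegSup.wSup (levWeight L η lev₁ 2) * MD) * MT * NegSup.wInvSup (levWeight L η levB 0) := by
  refine ContinuousLinearMap.opNorm_le_bound _ ?_ (norm_blockCLM115_apply_le lev₁ Dc T hMT hT hD)
  exact mul_nonneg (mul_nonneg (le_max_of_le_left (NegSup.wSup (levWeight L η lev₀ 1)).coe_nonneg) hMT)
    (NegSup.wInvSup (levWeight L η levB 0)).coe_nonneg

end Jet

/-! ## §2 An `L²` operator read on the functions: sup→sup bound from the `L²` bound ((3.11) of [5]) -/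

section Read

variable {ι β : Type*} [Fintype ι] [Fintype β] {V : Type*} [NormedAddCommGroup V] [NormedSpace ℂ V]
  {W : Type*} [NormedAddCommGroup W] [InnerProductSpace ℂ W] (φ : W ≃ₗ[ℂ] V) {c₀ c₁ : ℝ} [Fact (0 < c₀)] [Fact (0 < c₁)]
  {Mφ Mφ' : ℝ} (hMφ : 0 ≤ Mφ) (hφ : ∀ w, ‖φ w‖ ≤ Mφ * ‖w‖) (hMφ' : 0 ≤ Mφ') (hφ' : ∀ X, ‖φ.symm X‖ ≤ Mφ' * ‖X‖)

include hMφ hφ hMφ' hφ' in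
/-- **AN `L²` OPERATOR READ ON THE FUNCTIONS IS SUP→SUP BOUNDED BY ITS `L²` BOUND**: for `T` between the constant-weight `L²` spaces (weights `c₁`
on `β`, `c₀` on `ι`; (3.11) of [5]) with `‖Tf‖ ≤ C_T‖f‖`, the function-level map `readFun φ … T` satisfies
`‖(readFun φ T)g‖_∞ ≤ M_φ·C_T·√(c₁·#β)·M_φ′/√c₀·‖g‖_∞` (`‖(Tf)(x)‖ ≤ ‖Tf‖/√c₀`; `‖f‖ ≤ √(c₁#β)·sup‖f(y)‖`).
[cite: Balaban1985BackgroundPropagators, (3.11) p.392; Balaban1985Averaging, (18)–(19) p.21] -/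
theorem norm_readFun_apply_le (T : WL2 ℂ (fun _ : β => c₁) W →ₗ[ℂ] WL2 ℂ (fun _ : ι => c₀) W) {CT : ℝ} (hCT : 0 ≤ CT)
    (hT : ∀ f, ‖T f‖ ≤ CT * ‖f‖) (g : β → V) :
    ‖readFun φ (fun _ : β => c₁) (fun _ : ι => c₀) T g‖ ≤ Mφ * CT * (Real.sqrt (c₁ * Fintype.card β) * Mφ') / Real.sqrt c₀ * ‖g‖ := by
  have hc₀ : 0 < c₀ := Fact.out
  have hs : 0 < Real.sqrt c₀ := Real.sqrt_pos.2 hc₀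
  -- the input read in `L²`
  have hf : ‖(funEquiv φ (fun _ : β => c₁)).symm g‖ ≤ Real.sqrt (c₁ * Fintype.card β) * (Mφ' * ‖g‖) :=
    norm_WL2_le_of_pointwise _ (by positivity) fun y => by
      rw [funEquiv_symm_apply]
      exact (hφ' _).trans (mul_le_mul_of_nonneg_left (norm_le_pi_norm g y) hMφ')
  have hTf : ‖T ((funEquiv φ (fun _ : β => c₁)).symm g)‖ ≤ CT * (Real.sqrt (c₁ * Fintype.card β) * (Mφ' * ‖g‖)) :=
    (hT _).trans (mul_le_mul_of_nonneg_left hf hCT)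
  refine (pi_norm_le_iff_of_nonneg (by positivity)).2 fun x => ?_
  rw [readFun_apply, funEquiv_apply]
  refine (hφ _).trans ?_
  have h1 := norm_apply_le_of_WL2 (T ((funEquiv φ (fun _ : β => c₁)).symm g)) x
  have h2 : ‖WL2.equiv ℂ (fun _ : ι => c₀) W (T ((funEquiv φ (fun _ : β => c₁)).symm g)) x‖ ≤
      CT * (Real.sqrt (c₁ * Fintype.card β) * (Mφ' * ‖g‖)) / Real.sqrt c₀ :=
    h1.trans (div_le_div_of_nonneg_right hTf hs.le)
  calc Mφ * ‖WL2.equiv ℂ (fun _ : ι => c₀) W (T ((funEquiv φ (fun _ : β => c₁)).symm g)) x‖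
      ≤ Mφ * (CT * (Real.sqrt (c₁ * Fintype.card β) * (Mφ' * ‖g‖)) / Real.sqrt c₀) := mul_le_mul_of_nonneg_left h2 hMφ
    _ = Mφ * CT * (Real.sqrt (c₁ * Fintype.card β) * Mφ') / Real.sqrt c₀ * ‖g‖ := by ring

end Read

/-! ## §3 The letters (L6) `H₁` and (L2) `𝔊` in the type of (115): operator norms from `L²` bounds -/

section Letters

variable {ι β κ : Type*} [Fintype ι] [Fintype β] [Fintype κ] {V : Type*} [NormedAddCommGroup V] [NormedSpace ℂ V] [FiniteDimensional ℂ V]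
  {L η : ℝ} [Fact (0 < L)] [Fact (0 < η)] {lev₀ : ι → ℕ} {levB : β → ℕ}
  {W : Type*} [NormedAddCommGroup W] [InnerProductSpace ℂ W] (φ : W ≃ₗ[ℂ] V) {c₀ c₁ : ℝ} [Fact (0 < c₀)] [Fact (0 < c₁)]
  {Mφ Mφ' : ℝ} (hMφ : 0 ≤ Mφ) (hφ : ∀ w, ‖φ w‖ ≤ Mφ * ‖w‖) (hMφ' : 0 ≤ Mφ') (hφ' : ∀ X, ‖φ.symm X‖ ≤ Mφ' * ‖X‖)

include hMφ hφ hMφ' hφ' in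
/-- **THE OPERATOR NORM OF (L6) `H₁` IN THE TYPE `|·|_(−0) → (115)` FROM ITS `L²` BOUND** — the bound (103) p. 293 of `H₁` in the cell's
finite-lattice reading: `‖H1CLM φ lev₁ ∇ H₁‖ ≤ max(w̄₀, w̄₁M_∇)·(M_φC_T√(c₁#β)M_φ′/√c₀)·w̲₀⁻¹` for `‖H₁b‖ ≤ C_T‖b‖` in `L²` and a sup→sup bound
`M_∇` of the derivative letter. [cite: Balaban1985Variational, (103) p.293, (117) p.295] -/
theorem norm_H1CLM_le (lev₁ : κ → ℕ) (Dc : (ι → V) →ₗ[ℂ] (κ → V)) (H₁ : WL2 ℂ (fun _ : β => c₁) W →ₗ[ℂ] WL2 ℂ (fun _ : ι => c₀) W)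
    {CT MD : ℝ} (hCT : 0 ≤ CT) (hH : ∀ b, ‖H₁ b‖ ≤ CT * ‖b‖) (hD : ∀ g, ‖Dc g‖ ≤ MD * ‖g‖) :
    ‖H1CLM (L := L) (η := η) (lev₀ := lev₀) (levB := levB) φ lev₁ Dc H₁‖ ≤
      max (NegSup.wSup (levWeight L η lev₀ 1) : ℝ) (NegSup.wSup (levWeight L η lev₁ 2) * MD) *
        (Mφ * CT * (Real.sqrt (c₁ * Fintype.card β) * Mφ') / Real.sqrt c₀) * NegSup.wInvSup (levWeight L η levB 0) :=
  norm_blockCLM115_le lev₁ Dc _ (by positivity) (norm_readFun_apply_le φ hMφ hφ hMφ' hφ' H₁ hCT hH) hD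

variable [FiniteDimensional ℂ W] {S F : Type*} [AddCommGroup S] [Module ℂ S]

omit [FiniteDimensional ℂ V] [Fact (0 < L)] [Fact (0 < η)] [Fact (0 < c₁)] in
/-- **The function-level `𝔊`-formula at the READ letters is the Hilbert-level `𝔊` read on the functions**: with `G₁`, `Q`, `Q† = Q*`, `D`, `D*` read
along `φ` (`G1Fun`, `QFun`, `QadjFun`, `DFun`, `DstarFun`), `B11Eq111FrakG.frakGLin` of the read letters `=` `readFun φ` of `frakGLin G₁ Q Q† K⁻¹ D R D*`
((3.153) `𝔊 = G₁ − G₁Q*(QG₁Q*)⁻¹QG₁ − G₁DRD*G₁` commutes with the identification). [cite: Balaban1985Variational, (110)–(111) p.294] -/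
theorem frakGLin_fun_eq_readFun {wB : β → ℝ} [Fact (∀ y, 0 < wB y)] (G₁ : WL2 ℂ (fun _ : ι => c₀) W →ₗ[ℂ] WL2 ℂ (fun _ : ι => c₀) W)
    (Q : WL2 ℂ (fun _ : ι => c₀) W →ₗ[ℂ] WL2 ℂ wB W) (Kinv : WL2 ℂ wB W →ₗ[ℂ] WL2 ℂ wB W) (D : S →ₗ[ℂ] WL2 ℂ (fun _ : ι => c₀) W)
    (Rr : S →ₗ[ℂ] S) (Dstar : WL2 ℂ (fun _ : ι => c₀) W →ₗ[ℂ] S) :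
    frakGLin (G1Fun φ G₁) (QFun φ Q) (QadjFun φ Q) Kinv (DFun φ D) Rr (DstarFun φ Dstar) =
      readFun φ (fun _ : ι => c₀) (fun _ : ι => c₀) (frakGLin G₁ Q (LinearMap.adjoint Q) Kinv D Rr Dstar) := by
  ext g x
  simp only [frakGLin_apply, G1Fun, QFun, QadjFun, DFun, DstarFun, readFun_apply, LinearMap.comp_apply, LinearEquiv.coe_coe,
    LinearEquiv.symm_apply_apply, map_sub]

include hMφ hφ hMφ' hφ' in
/-- **THE OPERATOR NORM OF (L2) `𝔊` IN THE TYPE `|·|_(−3) → (115)` FROM ITS `L²` BOUND** — (117)'s «|𝔊| ≤ B₀» in the cell's finite-lattice reading: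
`‖frakG lev₁ ∇ (G1Fun φ G₁) (QFun φ Q) (QadjFun φ Q) K⁻¹ (DFun φ D) R (DstarFun φ D*)‖ ≤ max(w̄₀, w̄₁M_∇)·(M_φC_G√(c₀#ι)M_φ′/√c₀)·w̲₃⁻¹` whenever the
Hilbert-level `𝔊 = frakGLin G₁ Q Q† K⁻¹ D R D*` has `‖𝔊x‖ ≤ C_G‖x‖`. [cite: Balaban1985Variational, (111) p.294, (117) p.295] -/
theorem norm_frakG_fun_le {wB : β → ℝ} [Fact (∀ y, 0 < wB y)] (lev₁ : κ → ℕ) (Dc : (ι → V) →ₗ[ℂ] (κ → V))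
    (G₁ : WL2 ℂ (fun _ : ι => c₀) W →ₗ[ℂ] WL2 ℂ (fun _ : ι => c₀) W) (Q : WL2 ℂ (fun _ : ι => c₀) W →ₗ[ℂ] WL2 ℂ wB W)
    (Kinv : WL2 ℂ wB W →ₗ[ℂ] WL2 ℂ wB W) (D : S →ₗ[ℂ] WL2 ℂ (fun _ : ι => c₀) W) (Rr : S →ₗ[ℂ] S)
    (Dstar : WL2 ℂ (fun _ : ι => c₀) W →ₗ[ℂ] S) {CG MD : ℝ} (hCG : 0 ≤ CG)
    (hG : ∀ x, ‖frakGLin G₁ Q (LinearMap.adjoint Q) Kinv D Rr Dstar x‖ ≤ CG * ‖x‖) (hD : ∀ g, ‖Dc g‖ ≤ MD * ‖g‖) :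
    ‖frakG (L := L) (η := η) (lev₀ := lev₀) lev₁ Dc (G1Fun φ G₁) (QFun φ Q) (QadjFun φ Q) Kinv (DFun φ D) Rr (DstarFun φ Dstar)‖ ≤
      max (NegSup.wSup (levWeight L η lev₀ 1) : ℝ) (NegSup.wSup (levWeight L η lev₁ 2) * MD) *
        (Mφ * CG * (Real.sqrt (c₀ * Fintype.card ι) * Mφ') / Real.sqrt c₀) * NegSup.wInvSup (levWeight L η lev₀ 3) := by
  have h0 : frakG (L := L) (η := η) (lev₀ := lev₀) lev₁ Dc (G1Fun φ G₁) (QFun φ Q) (QadjFun φ Q) Kinv (DFun φ D) Rr (DstarFun φ Dstar) =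
      toCLM115 lev₁ Dc (readFun φ (fun _ : ι => c₀) (fun _ : ι => c₀) (frakGLin G₁ Q (LinearMap.adjoint Q) Kinv D Rr Dstar)) := by
    unfold frakG; rw [frakGLin_fun_eq_readFun]
  rw [h0]
  exact norm_toCLM115_le lev₁ Dc _ (by positivity) (norm_readFun_apply_le φ hMφ hφ hMφ' hφ' _ hCG hG) hD

end Letters

/-! ## §4 The derivative letter `∇_{U₀}` of (115) at a unit-bounded background: `‖∇_{U₀}A‖_∞ ≤ 2|η|⁻¹‖A‖_∞` -/

section Nabla

variable {d : ℕ} {Pd : Fin d → ℕ} {𝔸 : Type*} [NormedRing 𝔸] [NormedAlgebra ℂ 𝔸]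

/-- **`‖∇_{U₀}A‖_∞ ≤ 2‖η⁻¹‖·‖A‖_∞` for a unit-bounded background** (`‖U₀(b)‖ ≤ 1`, `‖U₀(b)⁻¹‖ ≤ 1`, e.g. unitary bond variables): the covariant
derivative (3.3) `η⁻¹(U₀ A(b₊) U₀⁻¹ − A(b₋))` of [5] inside (115) is sup→sup bounded UNIFORMLY in such backgrounds.
[cite: Balaban1985BackgroundPropagators, (3.3) p.391; Balaban1985Variational, (115) p.294] -/
theorem norm_nabla115_le (η : ℝ) (U₀ : Bond d Pd → 𝔸ˣ) (hUb : ∀ b, ‖(U₀ b : 𝔸)‖ ≤ 1 ∧ ‖(((U₀ b)⁻¹ : 𝔸ˣ) : 𝔸)‖ ≤ 1)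
    (A : Bond d Pd → 𝔸) : ‖nabla115 η U₀ A‖ ≤ 2 * ‖((η : ℂ))⁻¹‖ * ‖A‖ := by
  refine (pi_norm_le_iff_of_nonneg (by positivity)).2 fun bν => ?_
  obtain ⟨b, ν⟩ := bν
  rw [nabla115_apply]
  refine (norm_smul_le _ _).trans ?_
  have h1 : ‖(U₀ b : 𝔸) * A (B9SectCLatticeCarrier.btgt b, ν) * (((U₀ b)⁻¹ : 𝔸ˣ) : 𝔸)‖ ≤ ‖A‖ := by
    refine (norm_mul_le _ _).trans ?_
    refine (mul_le_mul (norm_mul_le _ _) (hUb b).2 (norm_nonneg _) (by positivity)).trans ?_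
    have hA : ‖A (B9SectCLatticeCarrier.btgt b, ν)‖ ≤ ‖A‖ := norm_le_pi_norm A _
    calc ‖(U₀ b : 𝔸)‖ * ‖A (B9SectCLatticeCarrier.btgt b, ν)‖ * 1 ≤ 1 * ‖A‖ * 1 :=
          mul_le_mul_of_nonneg_right (mul_le_mul (hUb b).1 hA (norm_nonneg _) zero_le_one) zero_le_one
      _ = ‖A‖ := by ring
  have h2 : ‖A (B9SectCLatticeCarrier.bpos b, ν)‖ ≤ ‖A‖ := norm_le_pi_norm A _
  have h3 := norm_sub_le ((U₀ b : 𝔸) * A (B9SectCLatticeCarrier.btgt b, ν) * (((U₀ b)⁻¹ : 𝔸ˣ) : 𝔸)) (A (B9SectCLatticeCarrier.bpos b, ν))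
  calc ‖((η : ℂ))⁻¹‖ * ‖(U₀ b : 𝔸) * A (B9SectCLatticeCarrier.btgt b, ν) * (((U₀ b)⁻¹ : 𝔸ˣ) : 𝔸) - A (B9SectCLatticeCarrier.bpos b, ν)‖
      ≤ ‖((η : ℂ))⁻¹‖ * (‖A‖ + ‖A‖) := mul_le_mul_of_nonneg_left (h3.trans (add_le_add h1 h2)) (norm_nonneg _)
    _ = 2 * ‖((η : ℂ))⁻¹‖ * ‖A‖ := by ring

end Nabla

end Literature.MathematicalPhysics.QuantumFieldTheory.Balaban1983to89.B11Eq117TransformationNorm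

end
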